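import Literature.Geometry.Riemannian.ExpMapNormalBalls
import Literature.Geometry.Riemannian.ExponentialMapCornerCutting
import Literature.Geometry.Riemannian.HopfRinowCompact
import HarnessLib

/-!
# Metric segments are geodesics; geodesic segments do not branch (Lee 2018, Thm. 6.4, Cor. 6.12)

Layer R1 of the programme towards `cutLocus_isClosed_and_mem_of_two_le` (`CutLocusBishop.lean`),
whose clause (2) was reduced in `CutLocusBishopProofs.lean`
(`mem_cutLocus_of_two_le_multiplicity_of_nonbranching`) to the **non-branching of unit-speed
metric segments**. Here we prove that statement for a Riemannian metric with smooth, geodesically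
complete Levi-Civita connection on a Hausdorff manifold without boundary:

* `ofReal_two_mul_le_edist_of_segment` — the elementary lower bound `d(P', Q') ≥ 2s` for points
  `P', Q'` within `s_P - s`, `s_Q - s` of the ends of a segment of length `s_P + s_Q`;
* `edist_expMap_smul_le` — `d(exp_x(s u), exp_x(s' u)) ≤ s' - s` for unit `u`, `s ≤ s'`;
* `segment_locally_radial` — **a unit-speed metric segment is, near each interior point `σ(t₁)`,
  the radial geodesic `t ↦ γ_a(t - t₁)` for a unit `a ∈ T_{σ(t₁)}M`**: inside a normal ball
  around `σ(t₁)` (`exists_riemannianExpMap_eq_of_edist_lt_of_le`, `ExpMapNormalBalls.lean`,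
  Lee Cor. 6.12–6.13) write `σ(t) = exp(V(t))`, `|V(t)|_g = |t - t₁|`; for `t₀ < t₁ < t₂` the directions
  `u = V(t₀)/(t₀ - t₁)`, `w = V(t₂)/(t₂ - t₁)` coincide, for otherwise corner cutting
  (`exists_edist_riemannianExpMap_lt_two_mul`, Lee p. 168) gives
  `d(exp(-su), exp(sw)) < 2s`, contradicting the lower bound (this is Lee's "minimizing curves
  are geodesics", Thm. 6.4 with Cor. 6.12, in the metric setting where the curve is only known to
  be distance-realising);
* `segment_eq_maximalGeodesic` — hence (connectedness of `(0, ℓ)` and uniqueness of geodesics,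
  `IsGeodesicOn.eqOn_of_velocity_eq_holds`) **the whole segment is one geodesic**,
  `σ(t) = γ_a(t - t₁)` on `[0, ℓ]`;
* `unitSpeed_segment_nonbranching` — **two unit-speed segments on `[0, ℓ]` that agree on a
  subinterval `[a, b]`, `a < b`, agree on `[0, ℓ]`** — hypothesis `hNB` of
  `mem_cutLocus_of_two_le_multiplicity_of_nonbranching`.

No definitions and no named facts are introduced (D-0026).

## References

* J. M. Lee, *Introduction to Riemannian Manifolds*, 2nd ed. (2018), Thm. 6.4, Cor. 6.12–6.13,
  Lemma 6.18 (proof, p. 168), Prop. 10.32 (proof). [LeeRiemannianManifolds2018]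
-/

noncomputable section

open Bundle Set Filter Function Manifold Metric
open scoped Manifold ContDiff Topology ENNReal

namespace Literature.Geometry.Riemannian

open Literature.Geometry.Lorentzian
open Literature.Geometry.Lorentzian.PseudoRiemannianMetric

variable {E : Type*} [NormedAddCommGroup E] [NormedSpace ℝ E] {H : Type*} [TopologicalSpace H]
  {I : ModelWithCorners ℝ E H} {M : Type*} [TopologicalSpace M] [ChartedSpace H M]
  [IsManifold I ∞ M] {n : ℕ∞ω} [FiniteDimensional ℝ E]
  (g : PseudoRiemannianMetric I n E (TangentSpace I : M → Type _))

/-! ### Two elementary distance estimates -/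

/-- **Lower bound near the middle of a segment**: if `d(P, Q) = s_P + s_Q`, `d(P, P') ≤ s_P - s`
and `d(Q', Q) ≤ s_Q - s` (`0 ≤ s ≤ s_P, s_Q`), then `d(P', Q') ≥ 2s` (triangle inequality).
[folklore] -/
theorem ofReal_two_mul_le_edist_of_segment (hg : g.IsRiemannian) {P Q P' Q' : M}
    {sP sQ s : ℝ} (hs : 0 ≤ s) (hsP : s ≤ sP) (hsQ : s ≤ sQ)
    (hPQ : g.edist hg P Q = ENNReal.ofReal (sP + sQ))
    (hP : g.edist hg P P' ≤ ENNReal.ofReal (sP - s))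
    (hQ : g.edist hg Q' Q ≤ ENNReal.ofReal (sQ - s)) :
    ENNReal.ofReal (2 * s) ≤ g.edist hg P' Q' := by
  by_cases htop : g.edist hg P' Q' = ⊤
  · rw [htop]; exact le_top
  have htri : g.edist hg P Q ≤ g.edist hg P P' + g.edist hg P' Q' + g.edist hg Q' Q :=
    calc g.edist hg P Q ≤ g.edist hg P P' + g.edist hg P' Q := g.edist_triangle hg P P' Q
      _ ≤ g.edist hg P P' + (g.edist hg P' Q' + g.edist hg Q' Q) :=
          add_le_add le_rfl (g.edist_triangle hg P' Q' Q)
      _ = _ := (add_assoc _ _ _).symm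
  have h2 : ENNReal.ofReal (sP + sQ) ≤
      ENNReal.ofReal (sP - s) + g.edist hg P' Q' + ENNReal.ofReal (sQ - s) := by
    rw [← hPQ]
    exact htri.trans (add_le_add (add_le_add hP le_rfl) hQ)
  have hfin : ENNReal.ofReal (sP - s) + g.edist hg P' Q' + ENNReal.ofReal (sQ - s) ≠ ⊤ := by
    simp [htop]
  have h3 := ENNReal.toReal_mono hfin h2
  rw [ENNReal.toReal_add (by simp [htop]) ENNReal.ofReal_ne_top,
    ENNReal.toReal_add ENNReal.ofReal_ne_top htop, ENNReal.toReal_ofReal (by linarith),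
    ENNReal.toReal_ofReal (by linarith), ENNReal.toReal_ofReal (by linarith)] at h3
  calc ENNReal.ofReal (2 * s) ≤ ENNReal.ofReal (g.edist hg P' Q').toReal :=
        ENNReal.ofReal_le_ofReal (by linarith)
    _ = g.edist hg P' Q' := ENNReal.ofReal_toReal htop

variable [CompleteSpace E] [T2Space M] [BoundarylessManifold I M] [g.HasLeviCivita]
  [CovariantDerivative.ContMDiffCovariantDerivative g.leviCivita 1]

/-- **Radial distances**: on a complete Riemannian manifold, for a `g_x`-unit vector `u` and
`s ≤ s'`, `d(exp_x(s u), exp_x(s' u)) ≤ s' - s` (`exp_x(t u) = γ_u(t)` has unit speed; Lee 2018,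
Prop. 5.19 (b) and Cor. 5.6). [cite: LeeRiemannianManifolds2018, Prop. 5.19 (b)] -/
theorem edist_expMap_smul_le [Fact (1 ≤ n)] (hg : g.IsRiemannian)
    (hc : IsGeodesicallyComplete g.leviCivita)
    (x : M) {u : E} (hu : g.val x (show TangentSpace I x from u) (show TangentSpace I x from u) = 1)
    {s s' : ℝ} (hss' : s ≤ s') :
    g.edist hg (riemannianExpMap g x (show TangentSpace I x from s • u))
      (riemannianExpMap g x (show TangentSpace I x from s' • u)) ≤ ENNReal.ofReal (s' - s) := by
  have hdom := (maximalGeodesic_of_isGeodesicallyComplete hc x (show TangentSpace I x from u)).1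
  have h1 : ∀ t : ℝ, riemannianExpMap g x (show TangentSpace I x from t • u) =
      maximalGeodesic g.leviCivita x (show TangentSpace I x from u) t := fun t ↦
    eqOn_expMap_smul_maximalGeodesic (cov := g.leviCivita) x (show TangentSpace I x from u)
      (by rw [hdom]; exact mem_univ t)
  rw [h1, h1]
  exact edist_maximalGeodesic_le hg hc x hu hss'

/-! ### Metric segments are geodesics -/

/-- **A unit-speed metric segment is locally a radial geodesic** (Lee 2018, Thm. 6.4 "every
minimizing curve is a geodesic" with Cor. 6.12, in metric form). Let `σ : ℝ → M` satisfy
`d(σ s, σ t) = |s - t|` for `s, t ∈ [0, ℓ]`, on a Riemannian manifold (Hausdorff, without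
boundary) whose Levi-Civita connection is smooth and geodesically complete, and let
`t₁ ∈ (0, ℓ)`. Then there are a `g`-unit vector `a ∈ T_{σ(t₁)}M` and `ρ > 0` with
`σ(t) = γ_a(t - t₁)` whenever `|t - t₁| < ρ`. Proof: in a normal ball around `σ(t₁)`
(`exists_riemannianExpMap_eq_of_edist_lt_of_le`), `σ(t) = exp(V(t))` with `|V(t)|_g = |t - t₁|`; for
`t₀ < t₁ < t₂` the unit directions `V(t₀)/(t₀ - t₁)` and `V(t₂)/(t₂ - t₁)` agree, since
otherwise corner cutting (`exists_edist_riemannianExpMap_lt_two_mul`) contradicts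
`ofReal_two_mul_le_edist_of_segment`. [cite: LeeRiemannianManifolds2018, Thm. 6.4 and Cor. 6.12] -/
theorem segment_locally_radial (hn : (∞ : ℕ∞ω) ≤ n) (hg : g.IsRiemannian)
    (hc : IsGeodesicallyComplete g.leviCivita) {σ : ℝ → M} {ℓ : ℝ}
    (hσ : ∀ s ∈ Icc 0 ℓ, ∀ t ∈ Icc 0 ℓ, g.edist hg (σ s) (σ t) = ENNReal.ofReal |s - t|)
    {t₁ : ℝ} (ht₁ : t₁ ∈ Ioo 0 ℓ) :
    ∃ a : E, g.val (σ t₁) (show TangentSpace I (σ t₁) from a) (show TangentSpace I (σ t₁) from a) = 1 ∧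
      ∃ ρ > (0 : ℝ), ∀ t : ℝ, |t - t₁| < ρ →
        σ t = maximalGeodesic g.leviCivita (σ t₁) (show TangentSpace I (σ t₁) from a) (t - t₁) := by
  haveI : Fact (1 ≤ n) := ⟨le_trans (by exact_mod_cast le_top) hn⟩
  obtain ⟨ε, hε, hball⟩ := exists_riemannianExpMap_eq_of_edist_lt_of_le g hn hg (σ t₁)
  set G : E →L[ℝ] E →L[ℝ] ℝ := g.val (σ t₁) with hG
  have hGnn : ∀ v : E, 0 ≤ G v v := fun v ↦ by
    by_cases h0 : v = 0
    · simp [h0]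
    · exact (hg (σ t₁) v h0).le
  -- the radius `ρ`
  set ρ : ℝ := min ε (min t₁ (ℓ - t₁)) with hρ
  have hρpos : 0 < ρ := lt_min hε (lt_min ht₁.1 (by linarith [ht₁.2]))
  have hρε : ρ ≤ ε := min_le_left _ _
  have hρt₁ : ρ ≤ t₁ := (min_le_right _ _).trans (min_le_left _ _)
  have hρℓ : ρ ≤ ℓ - t₁ := (min_le_right _ _).trans (min_le_right _ _)
  have ht₁I : t₁ ∈ Icc 0 ℓ := ⟨ht₁.1.le, ht₁.2.le⟩
  -- `σ t = exp V` with `G V V = (t - t₁)²` for some `V`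
  have key : ∀ t : ℝ, |t - t₁| < ρ → t ∈ Icc 0 ℓ ∧ ∃ V : E,
      riemannianExpMap g (σ t₁) (show TangentSpace I (σ t₁) from V) = σ t ∧
      G V V = (t - t₁) ^ 2 := by
    intro t ht
    have ht' := abs_lt.1 ht
    have htI : t ∈ Icc 0 ℓ := ⟨by linarith [ht'.1], by linarith [ht'.2]⟩
    have hd : g.edist hg (σ t₁) (σ t) = ENNReal.ofReal |t₁ - t| := hσ t₁ ht₁I t htI
    have hlt : g.edist hg (σ t₁) (σ t) < ENNReal.ofReal ε := by
      rw [hd, ENNReal.ofReal_lt_ofReal_iff hε, abs_sub_comm]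
      exact lt_of_lt_of_le ht hρε
    obtain ⟨V, hV, hdist⟩ := hball (σ t) hlt
    rw [hd] at hdist
    have habs : Real.sqrt (G V V) = |t₁ - t| :=
      (ENNReal.ofReal_eq_ofReal_iff (Real.sqrt_nonneg _) (abs_nonneg _)).1 hdist
    have hsq : G V V = (t - t₁) ^ 2 := by
      rw [← Real.sq_sqrt (hGnn V), habs, sq_abs]
      ring
    exact ⟨htI, V, hV, hsq⟩
  -- the directions from `σ t₁` to `σ t₀` (reversed) and to `σ t₂` agree, `t₀ < t₁ < t₂`
  have claim : ∀ (t₀ t₂ : ℝ) (V₀ V₂ : E), |t₀ - t₁| < ρ → t₀ < t₁ → |t₂ - t₁| < ρ → t₁ < t₂ →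
      riemannianExpMap g (σ t₁) (show TangentSpace I (σ t₁) from V₀) = σ t₀ →
      G V₀ V₀ = (t₀ - t₁) ^ 2 →
      riemannianExpMap g (σ t₁) (show TangentSpace I (σ t₁) from V₂) = σ t₂ →
      G V₂ V₂ = (t₂ - t₁) ^ 2 →
      (t₀ - t₁)⁻¹ • V₀ = (t₂ - t₁)⁻¹ • V₂ := by
    intro t₀ t₂ V₀ V₂ h₀ h₀₁ h₂ h₁₂ hexp₀ hsq₀ hexp₂ hsq₂
    have ht₀I := (key t₀ h₀).1
    have ht₂I := (key t₂ h₂).1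
    by_contra hne
    set u : E := (t₀ - t₁)⁻¹ • V₀ with hu_def
    set w : E := (t₂ - t₁)⁻¹ • V₂ with hw_def
    have h01 : t₀ - t₁ ≠ 0 := sub_ne_zero.2 h₀₁.ne
    have h21 : t₂ - t₁ ≠ 0 := sub_ne_zero.2 h₁₂.ne'
    have hu : G u u = 1 := by
      simp only [hu_def, map_smul, smul_apply, smul_eq_mul, hsq₀]
      field_simp
    have hw : G w w = 1 := by
      simp only [hw_def, map_smul, smul_apply, smul_eq_mul, hsq₂]
      field_simp
    obtain ⟨s₀, hs₀, hcut⟩ := exists_edist_riemannianExpMap_lt_two_mul hg hc (σ t₁) hu hw hne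
    set sP : ℝ := t₁ - t₀ with hsP_def
    set sQ : ℝ := t₂ - t₁ with hsQ_def
    have hsP : 0 < sP := by simp only [hsP_def]; linarith
    have hsQ : 0 < sQ := by simp only [hsQ_def]; linarith
    set s : ℝ := min (s₀ / 2) (min sP sQ) with hs_def
    have hs_pos : 0 < s := lt_min (by linarith) (lt_min hsP hsQ)
    have hs_lt : s < s₀ := lt_of_le_of_lt (min_le_left _ _) (by linarith)
    have hssP : s ≤ sP := (min_le_right _ _).trans (min_le_left _ _)
    have hssQ : s ≤ sQ := (min_le_right _ _).trans (min_le_right _ _)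
    have hlt := hcut s hs_pos hs_lt
    -- the ends of the segment as radial points
    have hmul : (t₁ - t₀) * (t₀ - t₁)⁻¹ = -1 := by
      rw [show t₁ - t₀ = -(t₀ - t₁) by ring, neg_mul, mul_inv_cancel₀ h01]
    have hPu : sP • (-u) = V₀ := by
      simp only [hu_def, hsP_def, smul_neg, smul_smul, hmul, neg_smul, one_smul, neg_neg]
    have hQw : sQ • w = V₂ := by
      rw [hw_def, smul_smul, mul_inv_cancel₀ h21, one_smul]
    have hP : σ t₀ = riemannianExpMap g (σ t₁) (show TangentSpace I (σ t₁) from sP • (-u)) := by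
      rw [← hexp₀]
      congr 1
      exact hPu.symm
    have hQ : σ t₂ = riemannianExpMap g (σ t₁) (show TangentSpace I (σ t₁) from sQ • w) := by
      rw [← hexp₂]
      congr 1
      exact hQw.symm
    have hnu : G (-u) (-u) = 1 := by simp [hu]
    have hdP : g.edist hg (σ t₀) (riemannianExpMap g (σ t₁) (show TangentSpace I (σ t₁) from (-s) • u))
        ≤ ENNReal.ofReal (sP - s) := by
      rw [hP, g.edist_comm hg, show (-s) • u = s • (-u) by simp]
      exact edist_expMap_smul_le g hg hc (σ t₁) hnu hssP
    have hdQ : g.edist hg (riemannianExpMap g (σ t₁) (show TangentSpace I (σ t₁) from s • w)) (σ t₂)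
        ≤ ENNReal.ofReal (sQ - s) := by
      rw [hQ]
      exact edist_expMap_smul_le g hg hc (σ t₁) hw hssQ
    have hPQ : g.edist hg (σ t₀) (σ t₂) = ENNReal.ofReal (sP + sQ) := by
      rw [hσ t₀ ht₀I t₂ ht₂I]
      congr 1
      rw [abs_of_neg (by linarith)]
      simp only [hsP_def, hsQ_def]; ring
    have hge := ofReal_two_mul_le_edist_of_segment g hg hs_pos.le hssP hssQ hPQ hdP hdQ
    exact absurd hlt (not_lt.2 hge)
  -- the common direction `a`
  set t₀' : ℝ := t₁ - ρ / 2 with ht₀'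
  set t₂' : ℝ := t₁ + ρ / 2 with ht₂'
  have h₀' : |t₀' - t₁| < ρ := by
    rw [ht₀', show t₁ - ρ / 2 - t₁ = -(ρ / 2) by ring, abs_neg, abs_of_pos (by positivity)]
    linarith
  have h₂' : |t₂' - t₁| < ρ := by
    rw [ht₂', show t₁ + ρ / 2 - t₁ = ρ / 2 by ring, abs_of_pos (by positivity)]
    linarith
  have h₀'lt : t₀' < t₁ := by simp only [ht₀']; linarith
  have h₂'gt : t₁ < t₂' := by simp only [ht₂']; linarith
  obtain ⟨-, V₀', hexp₀', hsq₀'⟩ := key t₀' h₀'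
  obtain ⟨-, V₂', hexp₂', hsq₂'⟩ := key t₂' h₂'
  set a : E := (t₀' - t₁)⁻¹ • V₀' with ha_def
  have ha : G a a = 1 := by
    have h01 : t₀' - t₁ ≠ 0 := sub_ne_zero.2 h₀'lt.ne
    simp only [ha_def, map_smul, smul_apply, smul_eq_mul, hsq₀']
    field_simp
  have hV : ∀ (t : ℝ) (V : E), |t - t₁| < ρ → t ≠ t₁ →
      riemannianExpMap g (σ t₁) (show TangentSpace I (σ t₁) from V) = σ t →
      G V V = (t - t₁) ^ 2 → V = (t - t₁) • a := by
    intro t V ht hne hexp hsq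
    rcases lt_or_gt_of_ne hne with hlt | hgt
    · have h1 := claim t t₂' V V₂' ht hlt h₂' h₂'gt hexp hsq hexp₂' hsq₂'
      have h2 := claim t₀' t₂' V₀' V₂' h₀' h₀'lt h₂' h₂'gt hexp₀' hsq₀' hexp₂' hsq₂'
      have h3 : (t - t₁)⁻¹ • V = a := by rw [ha_def, h2]; exact h1
      rw [← h3, smul_smul, mul_inv_cancel₀ (sub_ne_zero.2 hlt.ne), one_smul]
    · have h1 := claim t₀' t V₀' V h₀' h₀'lt ht hgt hexp₀' hsq₀' hexp hsq
      have h3 : (t - t₁)⁻¹ • V = a := by rw [ha_def]; exact h1.symm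
      rw [← h3, smul_smul, mul_inv_cancel₀ (sub_ne_zero.2 hgt.ne'), one_smul]
  refine ⟨a, ha, ρ, hρpos, fun t ht ↦ ?_⟩
  have hdom := (maximalGeodesic_of_isGeodesicallyComplete hc (σ t₁)
    (show TangentSpace I (σ t₁) from a)).1
  have hexpa : σ t = riemannianExpMap g (σ t₁) (show TangentSpace I (σ t₁) from (t - t₁) • a) := by
    rcases eq_or_ne t t₁ with heq | hne
    · subst heq
      rw [sub_self, zero_smul]
      exact (riemannianExpMap_zero g (σ t)).symm
    · obtain ⟨-, V, hexp, hsq⟩ := key t ht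
      rw [← hV t V ht hne hexp hsq]
      exact hexp.symm
  calc σ t = riemannianExpMap g (σ t₁) (show TangentSpace I (σ t₁) from (t - t₁) • a) := hexpa
    _ = expMap g.leviCivita (σ t₁) ((t - t₁) • (show TangentSpace I (σ t₁) from a)) := rfl
    _ = maximalGeodesic g.leviCivita (σ t₁) (show TangentSpace I (σ t₁) from a) (t - t₁) :=
        eqOn_expMap_smul_maximalGeodesic (cov := g.leviCivita) (σ t₁)
          (show TangentSpace I (σ t₁) from a) (by rw [hdom]; exact mem_univ (t - t₁))

/-- **A unit-speed metric segment is a geodesic** (Lee 2018, Thm. 6.4 with Cor. 6.12, metric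
form): with `σ`, `t₁` as in `segment_locally_radial`, `σ(t) = γ_a(t - t₁)` for **all**
`t ∈ [0, ℓ]`. Proof: the set of `t ∈ (0, ℓ)` near which `σ` agrees with `γ(t) = γ_a(t - t₁)` is
open, contains `t₁`, and is closed in `(0, ℓ)` — at a limit point `t*`, `σ` is near `t*` a
geodesic `γ*` (`segment_locally_radial`) which agrees with `γ` near points of the set, hence
everywhere (`IsGeodesicOn.eqOn_of_velocity_eq_holds`); the endpoints follow by continuity.
[cite: LeeRiemannianManifolds2018, Thm. 6.4 and Cor. 6.12] -/
theorem segment_eq_maximalGeodesic (hn : (∞ : ℕ∞ω) ≤ n) (hg : g.IsRiemannian)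
    (hc : IsGeodesicallyComplete g.leviCivita) {σ : ℝ → M} {ℓ : ℝ}
    (hσ : ∀ s ∈ Icc 0 ℓ, ∀ t ∈ Icc 0 ℓ, g.edist hg (σ s) (σ t) = ENNReal.ofReal |s - t|)
    {t₁ : ℝ} (ht₁ : t₁ ∈ Ioo 0 ℓ) :
    ∃ a : E, g.val (σ t₁) (show TangentSpace I (σ t₁) from a) (show TangentSpace I (σ t₁) from a) = 1 ∧
      ∀ t ∈ Icc 0 ℓ,
        σ t = maximalGeodesic g.leviCivita (σ t₁) (show TangentSpace I (σ t₁) from a) (t - t₁) := by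
  haveI := Manifold.locallyCompact_of_finiteDimensional (M := M) I
  obtain ⟨a, ha, ρ, hρ, hloc⟩ := segment_locally_radial g hn hg hc hσ ht₁
  refine ⟨a, ha, ?_⟩
  -- the translated geodesic `γ t = γ_a (t - t₁)` as a maximal geodesic
  set x₁ := σ t₁ with hx₁
  set γa := maximalGeodesic g.leviCivita x₁ (show TangentSpace I x₁ from a) with hγa
  set γ : ℝ → M := maximalGeodesic g.leviCivita (γa (-t₁)) (velocity I γa (-t₁)) with hγ_def
  have hγ_eq : ∀ t, γ t = γa (t - t₁) := fun t ↦ by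
    rw [hγ_def, maximalGeodesic_velocity_apply hc, sub_eq_add_neg]
  have hγgeod : IsGeodesic g.leviCivita γ :=
    (maximalGeodesic_of_isGeodesicallyComplete hc (γa (-t₁)) (velocity I γa (-t₁))).2.1
  -- translated geodesics through other points are geodesics too; uniqueness
  have huniq : ∀ {γ₁ γ₂ : ℝ → M}, IsGeodesic g.leviCivita γ₁ → IsGeodesic g.leviCivita γ₂ →
      ∀ t, γ₁ =ᶠ[𝓝 t] γ₂ → ∀ s, γ₁ s = γ₂ s := by
    intro γ₁ γ₂ h₁ h₂ t ht s
    have hpt : γ₁ t = γ₂ t := ht.eq_of_nhds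
    have hvel : velocity I γ₁ t = velocity I γ₂ t := velocity_congr_of_eventuallyEq ht
    exact IsGeodesicOn.eqOn_of_velocity_eq_holds (cov := g.leviCivita) isOpen_univ
      ordConnected_univ (h₁.isGeodesicOn univ) (h₂.isGeodesicOn univ) (mem_univ t) hpt hvel
      (mem_univ s)
  -- the clopen set
  set J : Set ℝ := {t | σ =ᶠ[𝓝 t] γ} with hJ
  have hJopen : IsOpen J := by
    rw [isOpen_iff_mem_nhds]
    intro t ht
    exact ht.eventually_nhds
  have hloc' : ∀ {t' : ℝ} (ht' : t' ∈ Ioo 0 ℓ), ∃ γ' : ℝ → M, IsGeodesic g.leviCivita γ' ∧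
      ∃ ρ' > (0 : ℝ), ∀ t, |t - t'| < ρ' → σ t = γ' t := by
    intro t' ht'
    obtain ⟨a', -, ρ', hρ', hloc'⟩ := segment_locally_radial g hn hg hc hσ ht'
    set γa' := maximalGeodesic g.leviCivita (σ t') (show TangentSpace I (σ t') from a')
    refine ⟨maximalGeodesic g.leviCivita (γa' (-t')) (velocity I γa' (-t')),
      (maximalGeodesic_of_isGeodesicallyComplete hc (γa' (-t')) (velocity I γa' (-t'))).2.1,
      ρ', hρ', fun t ht ↦ ?_⟩
    rw [maximalGeodesic_velocity_apply hc, ← sub_eq_add_neg]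
    exact hloc' t ht
  have hball_nhds : ∀ (t' ρ' : ℝ), 0 < ρ' → {t : ℝ | |t - t'| < ρ'} ∈ 𝓝 t' := fun t' ρ' hρ' ↦ by
    have : {t : ℝ | |t - t'| < ρ'} = Metric.ball t' ρ' := by
      ext t; simp [Metric.mem_ball, Real.dist_eq]
    rw [this]; exact Metric.ball_mem_nhds t' hρ'
  have ht₁J : t₁ ∈ J := by
    show σ =ᶠ[𝓝 t₁] γ
    filter_upwards [hball_nhds t₁ ρ hρ] with t ht
    rw [hloc t ht, hγ_eq]
  have hsub : Ioo 0 ℓ ⊆ J := by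
    refine isPreconnected_Ioo.subset_of_closure_inter_subset hJopen ⟨t₁, ht₁, ht₁J⟩ ?_
    rintro t' ⟨ht'c, ht'⟩
    obtain ⟨γ', hγ', ρ', hρ', hσγ'⟩ := hloc' ht'
    obtain ⟨t'', ht''J, hdist⟩ := Metric.mem_closure_iff.1 ht'c (ρ' / 2) (by positivity)
    -- near `t''`, `σ = γ` and `σ = γ'`, so `γ = γ'` near `t''`, hence everywhere
    have hγγ' : γ =ᶠ[𝓝 t''] γ' := by
      have h1 : σ =ᶠ[𝓝 t''] γ := ht''J
      have h2 : σ =ᶠ[𝓝 t''] γ' := by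
        filter_upwards [hball_nhds t'' (ρ' / 2) (by positivity)] with t ht
        apply hσγ' t
        calc |t - t'| ≤ |t - t''| + |t'' - t'| := abs_sub_le t t'' t'
          _ < ρ' / 2 + ρ' / 2 := by
              apply add_lt_add ht; rw [← Real.dist_eq, dist_comm]; exact hdist
          _ = ρ' := by ring
      exact h1.symm.trans h2
    have hall := huniq hγgeod hγ' t'' hγγ' 
    show σ =ᶠ[𝓝 t'] γ
    filter_upwards [hball_nhds t' ρ' hρ'] with t ht
    rw [hσγ' t ht, hall t]
  -- conclusion on the open interval
  have hIoo : ∀ t ∈ Ioo 0 ℓ, σ t = γ t := fun t ht ↦ (hsub ht).eq_of_nhds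
  -- endpoints by continuity
  have hℓ : 0 < ℓ := ht₁.1.trans ht₁.2
  have hγcont : Continuous γ := hγgeod.continuous
  have hend : ∀ t₀ ∈ Icc 0 ℓ, (𝓝[Ioo 0 ℓ] t₀).NeBot → σ t₀ = γ t₀ := by
    intro t₀ ht₀ hne
    haveI := hne
    have hσt : Tendsto σ (𝓝[Ioo 0 ℓ] t₀) (𝓝 (σ t₀)) := by
      rw [(g.nhds_hasBasis_edist hg (σ t₀)).tendsto_right_iff]
      intro r hr
      have hof : Tendsto (fun t : ℝ ↦ ENNReal.ofReal |t₀ - t|) (𝓝[Ioo 0 ℓ] t₀) (𝓝 0) := by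
        have h1 : Tendsto (fun t : ℝ ↦ |t₀ - t|) (𝓝 t₀) (𝓝 0) := by
          have : Continuous fun t : ℝ ↦ |t₀ - t| := by fun_prop
          simpa using this.tendsto t₀
        have h2 := (ENNReal.continuous_ofReal.tendsto 0).comp h1
        rw [ENNReal.ofReal_zero] at h2
        exact h2.mono_left nhdsWithin_le_nhds
      filter_upwards [hof.eventually (gt_mem_nhds hr), self_mem_nhdsWithin] with t ht htI
      show g.edist hg (σ t₀) (σ t) < r
      rw [hσ t₀ ht₀ t ⟨htI.1.le, htI.2.le⟩]
      exact ht
    have hγt : Tendsto σ (𝓝[Ioo 0 ℓ] t₀) (𝓝 (γ t₀)) := by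
      have h1 : Tendsto γ (𝓝[Ioo 0 ℓ] t₀) (𝓝 (γ t₀)) :=
        (hγcont.tendsto t₀).mono_left nhdsWithin_le_nhds
      exact h1.congr' (by filter_upwards [self_mem_nhdsWithin] with t ht; exact (hIoo t ht).symm)
    exact tendsto_nhds_unique hσt hγt
  intro t ht
  rw [← hγ_eq]
  rcases eq_or_lt_of_le ht.1 with h0 | h0
  · subst h0
    exact hend 0 ht (left_nhdsWithin_Ioo_neBot hℓ)
  rcases eq_or_lt_of_le ht.2 with hℓ' | hℓ'
  · rw [hℓ']
    exact hend ℓ ⟨hℓ.le, le_rfl⟩ (right_nhdsWithin_Ioo_neBot hℓ)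
  exact hIoo t ⟨h0, hℓ'⟩

/-- **Unit-speed metric segments do not branch** (consequence of "minimizing curves are
geodesics", Lee 2018 Thm. 6.4 / Cor. 6.12, and uniqueness of geodesics; used in the proof of
Prop. 10.32): on a Riemannian manifold (Hausdorff, without boundary) whose Levi-Civita
connection is smooth and geodesically complete, two maps `σ₁, σ₂ : ℝ → M` with
`d(σᵢ s, σᵢ t) = |s - t|` on `[0, ℓ]` which agree on a subinterval `[a, b]`, `0 ≤ a < b ≤ ℓ`,
agree on `[0, ℓ]` — hypothesis `hNB` of `mem_cutLocus_of_two_le_multiplicity_of_nonbranching`.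
[cite: LeeRiemannianManifolds2018, Thm. 6.4, Cor. 6.12 and Prop. 10.32 (proof)] -/
theorem unitSpeed_segment_nonbranching (hn : (∞ : ℕ∞ω) ≤ n) (hg : g.IsRiemannian)
    (hc : IsGeodesicallyComplete g.leviCivita) (σ₁ σ₂ : ℝ → M) (ℓ a b : ℝ) (ha : 0 ≤ a)
    (hab : a < b) (hb : b ≤ ℓ)
    (h₁ : ∀ s ∈ Icc 0 ℓ, ∀ t ∈ Icc 0 ℓ, g.edist hg (σ₁ s) (σ₁ t) = ENNReal.ofReal |s - t|)
    (h₂ : ∀ s ∈ Icc 0 ℓ, ∀ t ∈ Icc 0 ℓ, g.edist hg (σ₂ s) (σ₂ t) = ENNReal.ofReal |s - t|)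
    (heq : EqOn σ₁ σ₂ (Icc a b)) : EqOn σ₁ σ₂ (Icc 0 ℓ) := by
  set t₁ : ℝ := (a + b) / 2 with ht₁_def
  have ht₁ : t₁ ∈ Ioo 0 ℓ := ⟨by simp only [ht₁_def]; linarith, by simp only [ht₁_def]; linarith⟩
  have ht₁ab : t₁ ∈ Ioo a b := ⟨by simp only [ht₁_def]; linarith, by simp only [ht₁_def]; linarith⟩
  obtain ⟨a₁, -, hσ₁⟩ := segment_eq_maximalGeodesic g hn hg hc h₁ ht₁
  obtain ⟨a₂, -, hσ₂⟩ := segment_eq_maximalGeodesic g hn hg hc h₂ ht₁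
  -- the two geodesics, as maximal geodesics on `ℝ`
  set γa₁ := maximalGeodesic g.leviCivita (σ₁ t₁) (show TangentSpace I (σ₁ t₁) from a₁)
  set γa₂ := maximalGeodesic g.leviCivita (σ₂ t₁) (show TangentSpace I (σ₂ t₁) from a₂)
  set γ₁ := maximalGeodesic g.leviCivita (γa₁ (-t₁)) (velocity I γa₁ (-t₁)) with hγ₁
  set γ₂ := maximalGeodesic g.leviCivita (γa₂ (-t₁)) (velocity I γa₂ (-t₁)) with hγ₂
  have hγ₁eq : ∀ t, γ₁ t = γa₁ (t - t₁) := fun t ↦ by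
    rw [hγ₁, maximalGeodesic_velocity_apply hc, sub_eq_add_neg]
  have hγ₂eq : ∀ t, γ₂ t = γa₂ (t - t₁) := fun t ↦ by
    rw [hγ₂, maximalGeodesic_velocity_apply hc, sub_eq_add_neg]
  have hg₁ : IsGeodesic g.leviCivita γ₁ :=
    (maximalGeodesic_of_isGeodesicallyComplete hc (γa₁ (-t₁)) (velocity I γa₁ (-t₁))).2.1
  have hg₂ : IsGeodesic g.leviCivita γ₂ :=
    (maximalGeodesic_of_isGeodesicallyComplete hc (γa₂ (-t₁)) (velocity I γa₂ (-t₁))).2.1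
  -- they agree near `t₁`
  have hnear : γ₁ =ᶠ[𝓝 t₁] γ₂ := by
    filter_upwards [Ioo_mem_nhds ht₁ab.1 ht₁ab.2] with t ht
    have htI : t ∈ Icc 0 ℓ := ⟨ha.trans ht.1.le, ht.2.le.trans hb⟩
    rw [hγ₁eq, hγ₂eq, ← hσ₁ t htI, ← hσ₂ t htI]
    exact heq ⟨ht.1.le, ht.2.le⟩
  have hpt : γ₁ t₁ = γ₂ t₁ := hnear.eq_of_nhds
  have hvel : velocity I γ₁ t₁ = velocity I γ₂ t₁ := velocity_congr_of_eventuallyEq hnear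
  have hall := IsGeodesicOn.eqOn_of_velocity_eq_holds (cov := g.leviCivita) isOpen_univ
    ordConnected_univ (hg₁.isGeodesicOn univ) (hg₂.isGeodesicOn univ) (mem_univ t₁) hpt hvel
  intro t ht
  rw [hσ₁ t ht, hσ₂ t ht, ← hγ₁eq, ← hγ₂eq]
  exact hall (mem_univ t)

end Literature.Geometry.Riemannian
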